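import Summits.ResolutionOfSingularities.ResolutionOfSingularities.Theorems.DeltaCutStellarLat

/-!
# StellarCut L20b — «LatentCut»: the LATENT HOP, generator half — the Artin–Schreier shape survives the blow-up of the
# codimension-two face `{H, K}` (`expOf L K ≥ 1`), given the guard `supp M' ⊆ V(H')`
# (lens-6 «barrier-complement carving», g36; engine of the cell `WORNCHypWildLat`)

For a `ncHypShapeLat p X E L H M`-datum (L20a) and a boundary member `K ≠ H` with latent exponent `expOf L K ≥ 1`, blow up the
face `C = V(H) ∩ V(K)` (`π`, exceptional generator `ε` at `x'`).  The terminal labels are transported at MARKING `0`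
(`E' = transformExp E π {H,K} 0`: they are hop-invariant, the new member gets `expOf E K`), the latent labels at MARKING `1`
(`L' = transformExp L π {H,K} 1`: the new member gets `expOf L K − 1`).  At `x' ∈ V(H')`:
`π^*h = h'·ε`, `π^*m_b = m_b'·(unit)`, `π^*m_μ = ε·m_μ'·(unit)`, so
`π^*(hᵖ + v(h − c m_μ) m_b m_μ^{p−1}) = εᵖ·(h'ᵖ + v'(h' − c' m_μ') m_b' m_μ'^{p−1})` and the controlled transform (colon by `εᵖ` in the
domain `𝒪_{X',x'}`) is again an Artin–Schreier stalk — NO weight hypothesis on the face (the factor `εᵖ` comes from `hᵖ` and from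
`(h − c m_μ)·m_μ^{p−1}`, not from the monomial).  The label clauses, the common boundary, `p = 0` and T18's coprime clause on the
terminal exponents persist (`expOf E' C' = expOf E K`, `expOf E' K₀' = expOf E K₀`).

* `span_pow_mul_generator_eq` — the monomial transport `(εⁿ·m') = (π^*m)` at marking `n ≤ weightOf E T` (T11's block, as a lemma);
* `ncHypShapeLat.exists_generator_transform` — the Artin–Schreier stalk at every `x' ∈ V(H')`;
* `ncHypShapeLat.transform_of_support_subset` — ★ the shape after the hop, given the guard.

0 sorry; axioms standard. [new] [cite: Kollar2007, (3.111) Step 3] [cite: BierstoneGrigorievMilmanWlodarczyk2011, §3.2 Lemma 3.2.1]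
[cite: CossartPiltant2008, Prop. 4.2] [cite: AtiyahMacdonald1969, Cor. 3.15]
-/
noncomputable section

open CategoryTheory CategoryTheory.Limits AlgebraicGeometry TopologicalSpace IsLocalRing
open Literature.AlgebraicGeometry.Resolution

namespace Summit.ResolutionOfSingularities.ResolutionOfSingularities.Theorems.DeltaCutClasses

open Summit.ResolutionOfSingularities.ResolutionOfSingularities.Theorems
open WeakOrderReduction ForcedTowerClasses

/-! ### §Local — the Artin–Schreier generator under a ring map -/

section LocalAlgebra

/-- the image of `hᵖ + v(h − c m_μ) m_b m_μ^{p−1}` under a ring map with `φ h = h'ε`, `φ m_b = m_b' v₂`, `φ m_μ = ε m_μ' v₃` is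
`εᵖ·(h'ᵖ + v'(h' − c' m_μ') m_b' m_μ'^{p−1})` with `v' = φ v·v₂·v₃^{p−1}`, `c' = φ c·v₃` (`p ≥ 1`). [folklore] -/
theorem map_latent_generator_eq {R S : Type*} [CommRing R] [CommRing S] (φ : R →+* S) {p : ℕ} (hp : 1 ≤ p)
    {h mb mμ : R} (c v : R) {h' ε mb' mμ' v₂ v₃ : S} (ha : φ h = h' * ε) (hb : φ mb = mb' * v₂) (hc : φ mμ = ε * mμ' * v₃) :
    φ (h ^ p + v * (h - c * mμ) * mb * mμ ^ (p - 1)) =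
      ε ^ p * (h' ^ p + (φ v * v₂ * v₃ ^ (p - 1)) * (h' - (φ c * v₃) * mμ') * mb' * mμ' ^ (p - 1)) := by
  obtain ⟨q, rfl⟩ : ∃ q, p = q + 1 := ⟨p - 1, by omega⟩
  simp only [map_add, map_pow, map_mul, map_sub, ha, hb, hc, Nat.add_sub_cancel]
  ring

end LocalAlgebra

/-! ### §Round — the latent hop, generator half -/

section Round

variable {X X' : Scheme.{0}} [IsLocallyNoetherian X] {π : X' ⟶ X} {H K : X.IdealSheafData}
  {E L : List (X.IdealSheafData × ℕ)} {T : Finset X.IdealSheafData} {p : ℕ} {M : MarkedIdeal X}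

/-- **MONOMIAL TRANSPORT at marking `n ≤ weightOf E T`** (T11's block (b) as a lemma): with `(m) = 𝓜(E)_{π x'}`, `(ε)` the
exceptional stalk and `(m') = 𝓜(transformExp E π T n)_{x'}`, one has `(εⁿ·m') = (π^*m)`. [cite: Kollar2007, (3.111) Step 3] -/
theorem span_pow_mul_generator_eq (hEs : HasSNC (H :: boundaryOf E)) (hT : ∀ K ∈ T, K ∈ H :: boundaryOf E)
    (hπ : IsBlowup π (T.sup id)) {n : ℕ} (hn : n ≤ weightOf E T) {x' : X'} {m : X.presheaf.stalk (π x')}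
    (hMx : stalkIdeal (monomialIdeal E) (π x') = Ideal.span {m}) {ε : X'.presheaf.stalk x'}
    (hε : stalkIdeal ((T.sup id).comap π) x' = Ideal.span {ε}) {m' : X'.presheaf.stalk x'}
    (hm' : stalkIdeal (monomialIdeal (transformExp E π T n)) x' = Ideal.span {m'}) :
    Ideal.span {ε ^ n * m'} = Ideal.span {(π.stalkMap x').hom m} := by
  haveI : IsProper π := hπ.isProper
  haveI : IsLocallyNoetherian X' := LocallyOfFiniteType.isLocallyNoetherian π
  have hE₀ : HasSNC (boundaryOf ((H, 0) :: E)) := hEs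
  have hT₀ : ∀ K ∈ T, K ∈ boundaryOf ((H, 0) :: E) := hT
  have hst := congrArg (fun J => stalkIdeal J x') (comap_monomialIdeal hE₀ hT₀ hπ)
  simp only [List.map_cons] at hst
  rw [stalkIdeal_comap_eq_map_stalkMap, monomialIdeal_cons_zero, hMx, Ideal.map_span, Set.image_singleton,
    stalkIdeal_mul, stalkIdeal_pow, hε, weightOf_cons_zero, monomialIdeal_cons_zero, Ideal.span_singleton_pow] at hst
  have hm₂ : Ideal.span {m'} = stalkIdeal (monomialIdeal
      (E.map fun p => (strictTransformIdeal π (T.sup id) p.1, p.2))) x' * Ideal.span {ε ^ (weightOf E T - n)} := by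
    rw [← hm', transformExp, monomialIdeal_append, monomialIdeal_singleton, stalkIdeal_mul, stalkIdeal_pow, hε,
      Ideal.span_singleton_pow]
  rw [hst, mul_comm (ε ^ n) m', ← Ideal.span_singleton_mul_span_singleton, hm₂, mul_assoc,
    Ideal.span_singleton_mul_span_singleton, ← pow_add, Nat.sub_add_cancel hn, mul_comm]

omit [IsLocallyNoetherian X] in
/-- the weight of the latent face: `weightOf E {H, K} = expOf E H + expOf E K` (`H ≠ K`). [folklore] -/
theorem weightOf_pairFace (hHK : H ≠ K) : weightOf E (pairFace H K) = expOf E H + expOf E K := by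
  classical
  rw [pairFace_eq_insert, weightOf_insert E (fun h => hHK (Finset.mem_singleton.mp h))]
  rfl

omit [IsLocallyNoetherian X] in
/-- the s.n.c. frame in terms of `L` (same boundary) -/
theorem ncHypShapeLat.hasSNC_L (hP : ncHypShapeLat p X E L H M) (hEs : HasSNC (H :: boundaryOf E)) : HasSNC (H :: boundaryOf L) := by
  rw [hP.boundaryOf_eq]; exact hEs

/-- ★ **THE LATENT HOP, GENERATOR HALF**: after blowing up the face `{H, K}` (`expOf L K ≥ 1`) of a `ncHypShapeLat`-datum, at every
`x' ∈ V(H')` the transformed stalk is again Artin–Schreier: `(h'ᵖ + v'(h' − c' m_μ') m_b' m_μ'^{p−1})` with `(h') = H'_{x'}`,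
`(m_b') = 𝓜(transformExp E π {H,K} 0)_{x'}`, `(m_μ') = 𝓜(transformExp L π {H,K} 1)_{x'}`, `c', v'` units. [new]
[cite: Kollar2007, (3.111) Step 3] [cite: CossartPiltant2008, Prop. 4.2] [cite: AtiyahMacdonald1969, Cor. 3.15] -/
theorem ncHypShapeLat.exists_generator_transform (hEs : HasSNC (H :: boundaryOf E)) (hK : K ∈ boundaryOf E) (hHK : H ≠ K)
    (hπ : IsBlowup π ((pairFace H K).sup id)) (hLK : 1 ≤ expOf L K) (hP : ncHypShapeLat p X E L H M) {x' : X'}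
    (hx' : x' ∈ (strictTransformIdeal π ((pairFace H K).sup id) H).support) :
    ∃ h' mb' mμ' c' v' : X'.presheaf.stalk x', IsUnit c' ∧ IsUnit v' ∧
      stalkIdeal (strictTransformIdeal π ((pairFace H K).sup id) H) x' = Ideal.span {h'} ∧
      stalkIdeal (monomialIdeal (transformExp E π (pairFace H K) 0)) x' = Ideal.span {mb'} ∧
      stalkIdeal (monomialIdeal (transformExp L π (pairFace H K) 1)) x' = Ideal.span {mμ'} ∧
      stalkIdeal (M.transform π ((pairFace H K).sup id)).ideal x' =
        Ideal.span {h' ^ p + v' * (h' - c' * mμ') * mb' * mμ' ^ (p - 1)} := by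
  classical
  haveI : IsProper π := hπ.isProper
  haveI : IsLocallyNoetherian X' := LocallyOfFiniteType.isLocallyNoetherian π
  set T := pairFace H K with hTdef
  have hT : ∀ K' ∈ T, K' ∈ H :: boundaryOf E := pair_subset_frame hK
  have hEsL : HasSNC (H :: boundaryOf L) := hP.hasSNC_L hEs
  have hTL : ∀ K' ∈ T, K' ∈ H :: boundaryOf L := by rw [hP.boundaryOf_eq]; exact hT
  have hEs' : HasSNC (strictTransformIdeal π (T.sup id) H :: boundaryOf (transformExp E π T 0)) :=
    hasSNC_ncShape_transform hEs hT hπ 0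
  have hEsL' : HasSNC (strictTransformIdeal π (T.sup id) H :: boundaryOf (transformExp L π T 1)) :=
    hasSNC_ncShape_transform hEsL hTL hπ 1
  haveI : IsRegularLocalRing (X'.presheaf.stalk x') := (hEs' x').1
  haveI : IsDomain (X'.presheaf.stalk x') := isDomain_of_isRegularLocalRing _
  have hy : π x' ∈ H.support := mem_support_of_mem_support_strictTransformIdeal hx'
  obtain ⟨h, mb, mμ, c, v, hc, hv, hHx, hbx, hμx, hIx⟩ := hP.exists_generator hy
  obtain ⟨h₀, -, hH₀⟩ := exists_ne_zero_stalkIdeal_eq_span hEs' List.mem_cons_self x'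
  obtain ⟨ε, hε0, hε⟩ := exists_ne_zero_stalkIdeal_eq_span hEs' (comap_mem_frame_transform 0) x'
  obtain ⟨mb', hmb'⟩ := exists_stalkIdeal_monomialIdeal_eq_span (hasSNC_boundaryOf_of_cons hEs') x'
  obtain ⟨mμ', hmμ'⟩ := exists_stalkIdeal_monomialIdeal_eq_span (hasSNC_boundaryOf_of_cons hEsL') x'
  set φ := (π.stalkMap x').hom with hφ
  -- (a) `π^*(h) = h₀·ε·v₁`
  have ha : Ideal.span {h₀ * ε} = Ideal.span {φ h} := by
    have := map_stalkIdeal_eq_mul_of_mem hEs hT hπ left_mem_pairFace x'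
    rw [hHx, Ideal.map_span, Set.image_singleton, hH₀, hε, Ideal.span_singleton_mul_span_singleton] at this
    exact this.symm
  obtain ⟨v₁, hv₁⟩ := Ideal.span_singleton_eq_span_singleton.mp ha
  -- (b) the two monomials: `π^*(m_b) = m_b'·v₂` (marking `0`), `π^*(m_μ) = ε·m_μ'·v₃` (marking `1 ≤ weightOf L T`)
  have hwL : 1 ≤ weightOf L T := by
    rw [hTdef, weightOf_pairFace hHK]; omega
  obtain ⟨v₂, hv₂⟩ := Ideal.span_singleton_eq_span_singleton.mp
    (span_pow_mul_generator_eq hEs hT hπ (Nat.zero_le _) hbx hε hmb')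
  obtain ⟨v₃, hv₃⟩ := Ideal.span_singleton_eq_span_singleton.mp (span_pow_mul_generator_eq hEsL hTL hπ hwL hμx hε hmμ')
  rw [pow_zero, one_mul] at hv₂
  rw [pow_one] at hv₃
  -- (c) the controlled transform
  have hp1 : 1 ≤ p := hP.prime.one_lt.le
  refine ⟨h₀ * ↑v₁, mb', mμ', φ c * ↑v₃, φ v * ↑v₂ * ↑v₃ ^ (p - 1), (hc.map φ).mul v₃.isUnit,
    ((hv.map φ).mul v₂.isUnit).mul (v₃.isUnit.pow _), ?_, hmb', hmμ', ?_⟩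
  · rw [hH₀, Ideal.span_singleton_mul_right_unit v₁.isUnit]
  · rw [MarkedIdeal.transform_ideal, hP.mult_eq, hπ.stalkIdeal_controlledTransform, stalkIdeal_comap_eq_map_stalkMap,
      hIx, Ideal.map_span, Set.image_singleton, hε, ← hφ,
      map_latent_generator_eq φ hp1 c v (h' := h₀ * ↑v₁) (ε := ε) (mb' := mb') (mμ' := mμ') (v₂ := ↑v₂) (v₃ := ↑v₃)
        (by rw [← hv₁]; ring) hv₂.symm hv₃.symm,
      colon_span_pow_mul hε0]

/-- **the label clause persists** (T11's block, for any marking `m`): the `H'`-entries of `transformExp E π T m` carry the label `0`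
(or `V(H') = ∅`). [folklore] -/
theorem label_transformExp (hEs : HasSNC (H :: boundaryOf E)) (hT : ∀ K ∈ T, K ∈ H :: boundaryOf E)
    (hπ : IsBlowup π (T.sup id)) (m : ℕ) (hlab : ∀ q ∈ E, q.1 = H → q.2 = 0 ∨ (H.support : Set X) = ∅) :
    ∀ q ∈ transformExp E π T m, q.1 = strictTransformIdeal π (T.sup id) H →
      q.2 = 0 ∨ ((strictTransformIdeal π (T.sup id) H).support : Set X') = ∅ := by
  haveI : IsProper π := hπ.isProper
  haveI : IsLocallyNoetherian X' := LocallyOfFiniteType.isLocallyNoetherian π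
  intro q hq hqH
  by_cases hV : ((strictTransformIdeal π (T.sup id) H).support : Set X') = ∅
  · exact Or.inr hV
  · refine Or.inl ?_
    obtain ⟨x', hx'⟩ := Set.nonempty_iff_ne_empty.mpr hV
    have hx'' : x' ∈ (strictTransformIdeal π (T.sup id) H).support := hx'
    rw [transformExp, List.mem_append, List.mem_map, List.mem_singleton] at hq
    rcases hq with ⟨p, hp, rfl⟩ | rfl
    · have hpE : p.1 ∈ H :: boundaryOf E := List.mem_cons_of_mem _ (fst_mem_boundaryOf hp)
      have heq : H = p.1 := eq_of_strictTransformIdeal_eq hEs hT hπ List.mem_cons_self hpE hx'' hqH.symm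
      have hy : π x' ∈ H.support := mem_support_of_mem_support_strictTransformIdeal hx''
      exact (hlab p hp heq.symm).resolve_right (Set.nonempty_iff_ne_empty.mp ⟨π x', hy⟩)
    · exfalso
      have hqH' : (T.sup id).comap π = strictTransformIdeal π (T.sup id) H := hqH
      have hxF : x' ∈ ((T.sup id).comap π).support := by rw [hqH']; exact hx''
      exact strictTransformIdeal_ne_comap hEs hT hπ List.mem_cons_self hxF hqH'.symm

/-- **T18's coprime clause persists under the latent hop at marking `0`**: the exponent of the exceptional divisor is
`weightOf E {H, K} = expOf E K` (coprime along `V(K) ⊇ π(V(C'))`), that of a strict transform `K₀'` is `expOf E K₀`. [new] -/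
theorem ncHypShapeLat.labels_transform (hEs : HasSNC (H :: boundaryOf E)) (hK : K ∈ boundaryOf E) (hHK : H ≠ K)
    (hπ : IsBlowup π ((pairFace H K).sup id)) (hP : ncHypShapeLat p X E L H M) (G : X'.IdealSheafData) (x' : X')
    (hx' : x' ∈ G.support) :
    expOf (transformExp E π (pairFace H K) 0) G = 0 ∨ ¬ p ∣ expOf (transformExp E π (pairFace H K) 0) G := by
  classical
  haveI : IsProper π := hπ.isProper
  haveI : IsLocallyNoetherian X' := LocallyOfFiniteType.isLocallyNoetherian π
  set T := pairFace H K with hTdef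
  have hT : ∀ K' ∈ T, K' ∈ H :: boundaryOf E := pair_subset_frame hK
  rw [expOf, weightOf_transformExp]
  by_cases hGF : (T.sup id).comap π ∈ ({G} : Finset X'.IdealSheafData)
  · -- the exceptional divisor: exponent `weightOf E T − 0 = expOf E K`
    have hGF' : (T.sup id).comap π = G := Finset.mem_singleton.mp hGF
    rw [if_pos hGF]
    have hxF : x' ∈ ((T.sup id).comap π).support := by rw [hGF']; exact hx'
    have hxC : π x' ∈ (T.sup id).support := by
      have h : x' ∈ ((((T.sup id).comap π).support : Set X')) := hxF
      rwa [Scheme.IdealSheafData.support_comap] at h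
    have hyT : ∀ K' ∈ T, π x' ∈ K'.support := (mem_support_finsetSup_iff T (π x')).mp hxC
    have hpre : pre E π T {G} = ∅ := by
      refine Finset.eq_empty_of_forall_notMem fun K' hK' => ?_
      obtain ⟨hKs, hKG⟩ := mem_pre_iff.mp hK'
      rw [Finset.mem_singleton, ← hGF'] at hKG
      exact strictTransformIdeal_ne_comap hEs hT hπ (List.mem_cons_of_mem _ (mem_sheaves_iff.mp hKs)) hxF hKG
    rw [hpre, weightOf_empty, zero_add, Nat.sub_zero, hTdef, weightOf_pairFace hHK, hP.expOfE_eq_zero (hyT H left_mem_pairFace),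
      zero_add]
    exact hP.labels (hyT K right_mem_pairFace)
  · -- a strict transform
    rw [if_neg hGF, add_zero]
    by_cases hex : ∃ K', K' ∈ pre E π T {G}
    · obtain ⟨K', hK'⟩ := hex
      obtain ⟨hKs, hKG⟩ := mem_pre_iff.mp hK'
      rw [Finset.mem_singleton] at hKG
      have hxK' : x' ∈ (strictTransformIdeal π (T.sup id) K').support := by rw [hKG]; exact hx'
      have hxK : π x' ∈ K'.support := mem_support_of_mem_support_strictTransformIdeal hxK'
      have hpre : pre E π T {G} = {K'} := by
        refine Finset.eq_singleton_iff_unique_mem.mpr ⟨hK', fun K'' hK'' => ?_⟩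
        obtain ⟨hK''s, hK''G⟩ := mem_pre_iff.mp hK''
        rw [Finset.mem_singleton] at hK''G
        exact (eq_of_strictTransformIdeal_eq hEs hT hπ (List.mem_cons_of_mem _ (mem_sheaves_iff.mp hKs))
          (List.mem_cons_of_mem _ (mem_sheaves_iff.mp hK''s)) hxK' (hKG.trans hK''G.symm)).symm
      rw [hpre]
      exact hP.labels hxK
    · push Not at hex
      rw [Finset.eq_empty_of_forall_notMem fun K' hK' => hex K' hK', weightOf_empty]
      exact Or.inl rfl

/-- ★ **THE ARTIN–SCHREIER SHAPE SURVIVES THE LATENT HOP, given the guard `supp M' ⊆ V(H')`**: terminal labels at marking `0`,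
latent labels at marking `1`. [new] [cite: Kollar2007, (3.111) Step 3] [cite: CossartPiltant2008, Prop. 4.2] -/
theorem ncHypShapeLat.transform_of_support_subset (hEs : HasSNC (H :: boundaryOf E)) (hK : K ∈ boundaryOf E) (hHK : H ≠ K)
    (hπ : IsBlowup π ((pairFace H K).sup id)) (hLK : 1 ≤ expOf L K) (hP : ncHypShapeLat p X E L H M)
    (hSupp : (M.transform π ((pairFace H K).sup id)).support ⊆
      ((strictTransformIdeal π ((pairFace H K).sup id) H).support : Set X')) :
    ncHypShapeLat p X' (transformExp E π (pairFace H K) 0) (transformExp L π (pairFace H K) 1)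
      (strictTransformIdeal π ((pairFace H K).sup id) H) (M.transform π ((pairFace H K).sup id)) := by
  haveI : IsProper π := hπ.isProper
  haveI : IsLocallyNoetherian X' := LocallyOfFiniteType.isLocallyNoetherian π
  have hT : ∀ K' ∈ pairFace H K, K' ∈ H :: boundaryOf E := pair_subset_frame hK
  have hTL : ∀ K' ∈ pairFace H K, K' ∈ H :: boundaryOf L := by rw [hP.boundaryOf_eq]; exact hT
  refine ⟨by rw [MarkedIdeal.transform_mult, hP.mult_eq], label_transformExp hEs hT hπ 0 fun _ hq hqH => hP.labelE hq hqH,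
    label_transformExp (hP.hasSNC_L hEs) hTL hπ 1 fun _ hq hqH => hP.labelL hq hqH, ?_,
    fun x' hx' => hP.exists_generator_transform hEs hK hHK hπ hLK hx', hSupp, hP.prime, fun x' => ?_,
    fun G x' hx' => hP.labels_transform hEs hK hHK hπ G x' hx'⟩
  · rw [boundaryOf_transformExp, boundaryOf_transformExp, hP.boundaryOf_eq]
  · have h := congrArg (π.stalkMap x').hom (hP.cast_eq_zero (π x'))
    rwa [map_natCast, map_zero] at h

end Round

end Summit.ResolutionOfSingularities.ResolutionOfSingularities.Theorems.DeltaCutClasses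

end
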